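import Mathlib
import HarnessLib

/-!
# Route R of crux K1 «MinimiserStabilityRegPr» (stmt-QuantumFields-19200) — STAMPACCHIA'S LEVEL ITERATION IN LATTICE FORM (integer tile sides,
# no fractional powers): an antitone counting function `A : ℝ → ℕ` with `A(0) ≤ M^d` and the De Giorgi step inequality
# `(h−k)²·A(h) ≤ C·ρ²·A(k)` whenever `4·A(k) ≤ ρ^d` VANISHES at every level `D > 0` with `D² ≥ 256·2^d·C·M²`
# (brick 2b-i of the flat linear interior-regularity core; cell `ym3-torus`, width seat `ym-ust-19200-w1` g6; OWNER ACK 22 (a);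
# `--supports stmt-QuantumFields-19200 --as helper`, count-neutral)

YM₃ on T³ is a RUNG of the ladder (R3), not the Clay problem; nothing here claims the stub, the crux or the gap.

WHY.  The `L^∞` bound for the box Dirichlet corrector of `−Δw = ∂*g` on `ℤ^d` (`Prop7FlatDirichletSup.abs_le_of_dirichlet`, the sourced half of route R's
interior mean-value input) is a De Giorgi ∕ Stampacchia truncation argument: the PDE part gives the step inequality for the counting function of the
super-level sets (`Prop7FlatDirichletSup.deGiorgi_step`, through the Faber–Krahn inequality `Prop7FlatFaberKrahnZd.faberKrahn`), and THIS file is the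
real-variable iteration that turns the step inequality into the vanishing of a level — kept separate because it is pure arithmetic (`import Mathlib` only).

WHAT IS PROVED (sorry-free, no definition).
* ★ `levels_vanish` — `A : ℝ → ℕ` antitone, `A(0) ≤ M^d` (`M ≥ 1`, `d ≥ 1`), `C ≥ 0`, step inequality for all `0 ≤ k < h` and all integer `ρ ≥ 1` with
  `4·A(k) ≤ ρ^d` ⟹ `A(D) = 0` for every `D > 0` with `256·2^d·C·M² ≤ D²`.  Proof: along the dyadic levels `k_n = D(1 − 2^{−n})` one has
  `A(k_n) ≤ M^d∕2^{nd}` as long as `2ⁿ ≤ 2M`, using the INTEGER tile side `ρ_n = 4·⌈M∕2ⁿ⌉ ≤ 8M∕2ⁿ`; at `n* = log₂M + 1` (`M < 2^{n*} ≤ 2M`, `Nat.log`)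
  the bound is `< 1`, so the natural number `A(k_{n*})` is `0`, and `k_{n*} ≤ D`.

HONEST SCOPE.  [folklore] real-variable lemma (Stampacchia's iteration; [Giaquinta1984] Ch. III §2 as method pointer); nothing of Bałaban's is asserted.

References: M. Giaquinta, *Multiple integrals in the calculus of variations and nonlinear elliptic systems*, Princeton UP 1983 [Giaquinta1984] (Ch. III §2).
-/

set_option autoImplicit false

noncomputable section

namespace Summit.QuantumFields.YangMills.Theorems.Prop7FlatLevelIteration

variable {d : ℕ}

/-! ## The level iteration (real-variable, integer tile sides, no fractional powers) -/

/-- **STAMPACCHIA'S ITERATION, LATTICE FORM.**  Let `A : ℝ → ℕ` be antitone with `A(0) ≤ M^d` (`M ≥ 1`, `d ≥ 1`), and suppose the step inequality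
`(h−k)²·A(h) ≤ C·ρ²·A(k)` holds for all `0 ≤ k < h` and all integer tile sides `ρ ≥ 1` with `4·A(k) ≤ ρ^d` (`C ≥ 0`).  Then `A(D) = 0` for every
`D > 0` with `256·2^d·C·M² ≤ D²`.  Proof: along the levels `k_n = D(1 − 2^{−n})`, `A(k_n) ≤ M^d∕2^{nd}` as long as `2ⁿ ≤ 2M` (tile side
`ρ_n = 4⌈M∕2ⁿ⌉ ≤ 8M∕2ⁿ`), and at the first `n` with `M < 2ⁿ ≤ 2M` (`Nat.log`) the bound drops below `1`. [folklore]
[cite: Giaquinta1984, Ch. III §2 p.78] -/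
theorem levels_vanish (hd : 1 ≤ d) (A : ℝ → ℕ) (hmono : ∀ k h : ℝ, k ≤ h → A h ≤ A k) {M : ℕ} (hM : 1 ≤ M)
    (hA0 : A 0 ≤ M ^ d) {C : ℝ} (hC : 0 ≤ C)
    (hstep : ∀ (k h : ℝ) (ρ : ℕ), 0 ≤ k → k < h → 1 ≤ ρ → 4 * A k ≤ ρ ^ d →
      (h - k) ^ 2 * (A h : ℝ) ≤ C * (ρ : ℝ) ^ 2 * (A k : ℝ))
    {D : ℝ} (hD : 0 < D) (hD2 : 256 * (2 : ℝ) ^ d * C * (M : ℝ) ^ 2 ≤ D ^ 2) : A D = 0 := by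
  -- the levels
  set k : ℕ → ℝ := fun n => D * (1 - (1 / 2 : ℝ) ^ n) with hk
  have hk0 : ∀ n, 0 ≤ k n := fun n => by
    have : (1 / 2 : ℝ) ^ n ≤ 1 := pow_le_one₀ (by norm_num) (by norm_num)
    simp only [hk]; nlinarith
  have hkD : ∀ n, k n ≤ D := fun n => by
    have : 0 ≤ (1 / 2 : ℝ) ^ n := by positivity
    simp only [hk]; nlinarith
  have hkstep : ∀ n, k (n + 1) - k n = D * (1 / 2 : ℝ) ^ (n + 1) := fun n => by
    simp only [hk, pow_succ]; ring
  have hklt : ∀ n, k n < k (n + 1) := fun n => by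
    have := hkstep n
    have : 0 < D * (1 / 2 : ℝ) ^ (n + 1) := by positivity
    linarith
  have hM0 : (0 : ℝ) < M := by exact_mod_cast hM
  have hMd : ((M ^ d : ℕ) : ℝ) = (M : ℝ) ^ d := by push_cast; ring
  -- the claim along the dyadic range
  have claim : ∀ n : ℕ, 2 ^ n ≤ 2 * M → (A (k n) : ℝ) ≤ (M : ℝ) ^ d / (2 : ℝ) ^ (n * d) := by
    intro n
    induction n with
    | zero =>
      intro _
      have : k 0 = 0 := by simp [hk]
      rw [this, zero_mul, pow_zero, div_one]
      exact_mod_cast hA0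
    | succ n ih =>
      intro hrange
      have hn : 2 ^ n ≤ M := by
        have : 2 ^ (n + 1) = 2 * 2 ^ n := by ring
        omega
      have ihn := ih (by omega)
      -- the tile side `ρ = 4c`, `c = ⌈M / 2ⁿ⌉`
      set c : ℕ := (M + 2 ^ n - 1) / 2 ^ n with hc
      have h2n : 0 < 2 ^ n := Nat.two_pow_pos n
      have hc1 : 1 ≤ c := by
        rw [hc, Nat.le_div_iff_mul_le h2n]; omega
      have hcM : M ≤ c * 2 ^ n := by
        have := Nat.lt_div_mul_add (a := M + 2 ^ n - 1) h2n
        rw [← hc] at this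
        have : M + 2 ^ n - 1 < c * 2 ^ n + 2 ^ n := by linarith
        omega
      have hcM' : c * 2 ^ n ≤ M + 2 ^ n - 1 := by rw [hc]; exact Nat.div_mul_le_self _ _
      have hc2 : c * 2 ^ n ≤ 2 * M := by omega
      set ρ : ℕ := 4 * c with hρ
      have hρ1 : 1 ≤ ρ := by omega
      -- real versions
      have h2nR : (0 : ℝ) < (2 : ℝ) ^ n := by positivity
      have hcMR : (M : ℝ) ≤ (c : ℝ) * (2 : ℝ) ^ n := by exact_mod_cast hcM
      have hc2R : (c : ℝ) * (2 : ℝ) ^ n ≤ 2 * (M : ℝ) := by exact_mod_cast hc2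
      have hρR : (ρ : ℝ) = 4 * c := by rw [hρ]; push_cast; ring
      -- `4·A(k n) ≤ ρ^d`
      have hAρ : 4 * A (k n) ≤ ρ ^ d := by
        have h1 : (4 : ℝ) * (A (k n) : ℝ) ≤ 4 * ((M : ℝ) ^ d / (2 : ℝ) ^ (n * d)) := by linarith
        have h2 : (M : ℝ) ^ d / (2 : ℝ) ^ (n * d) ≤ (c : ℝ) ^ d := by
          rw [div_le_iff₀ (by positivity), pow_mul, ← mul_pow]
          exact pow_le_pow_left₀ hM0.le hcMR d
        have h3 : (4 : ℝ) * (c : ℝ) ^ d ≤ (ρ : ℝ) ^ d := by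
          rw [hρR, mul_pow]
          have h4 : (4 : ℝ) ≤ (4 : ℝ) ^ d := by
            calc (4 : ℝ) = 4 ^ 1 := (pow_one _).symm
              _ ≤ 4 ^ d := pow_le_pow_right₀ (by norm_num) hd
          exact mul_le_mul_of_nonneg_right h4 (by positivity)
        have : (4 : ℝ) * (A (k n) : ℝ) ≤ (ρ : ℝ) ^ d := by nlinarith
        exact_mod_cast this
      -- the step inequality
      have hst := hstep (k n) (k (n + 1)) ρ (hk0 n) (hklt n) hρ1 hAρ
      rw [hkstep n] at hst
      -- `ρ ≤ 8M/2ⁿ`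
      have hρle : (ρ : ℝ) * (2 : ℝ) ^ n ≤ 8 * (M : ℝ) := by rw [hρR]; nlinarith
      have hρsq : (ρ : ℝ) ^ 2 * ((2 : ℝ) ^ n) ^ 2 ≤ 64 * (M : ℝ) ^ 2 := by
        have h0 : 0 ≤ (ρ : ℝ) * (2 : ℝ) ^ n := by positivity
        nlinarith
      -- conclude `A(k(n+1)) ≤ M^d / 2^{(n+1)d}`
      have hpos : 0 < (D * (1 / 2 : ℝ) ^ (n + 1)) ^ 2 := by positivity
      have key : (A (k (n + 1)) : ℝ) * (2 : ℝ) ^ ((n + 1) * d) ≤ (M : ℝ) ^ d := by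
        -- multiply the step inequality through
        have e1 : (D * (1 / 2 : ℝ) ^ (n + 1)) ^ 2 = D ^ 2 / (4 * ((2 : ℝ) ^ n) ^ 2) := by
          rw [eq_div_iff (by positivity), one_div_pow, mul_pow, div_pow, one_pow]
          field_simp
          ring
        have e2 : (2 : ℝ) ^ ((n + 1) * d) = (2 : ℝ) ^ d * (2 : ℝ) ^ (n * d) := by
          rw [← pow_add]; congr 1; ring
        have hAn : (A (k n) : ℝ) * (2 : ℝ) ^ (n * d) ≤ (M : ℝ) ^ d := by
          rwa [le_div_iff₀ (by positivity)] at ihn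
        have hAn0 : (0 : ℝ) ≤ A (k n) := Nat.cast_nonneg _
        have hAn1 : (0 : ℝ) ≤ A (k (n + 1)) := Nat.cast_nonneg _
        -- from `hst`: `D²/(4·4ⁿ)·A_{n+1} ≤ C ρ² A_n`, so `D²·A_{n+1} ≤ 4C(ρ2ⁿ)²A_n ≤ 256 C M² A_n`
        have s1 : D ^ 2 * (A (k (n + 1)) : ℝ) ≤ 4 * C * ((ρ : ℝ) ^ 2 * ((2 : ℝ) ^ n) ^ 2) * (A (k n) : ℝ) := by
          rw [e1] at hst
          have h4 : 0 < 4 * ((2 : ℝ) ^ n) ^ 2 := by positivity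
          have := mul_le_mul_of_nonneg_right hst h4.le
          calc D ^ 2 * (A (k (n + 1)) : ℝ) = D ^ 2 / (4 * ((2 : ℝ) ^ n) ^ 2) * (A (k (n + 1)) : ℝ) * (4 * ((2 : ℝ) ^ n) ^ 2) := by
                field_simp
            _ ≤ C * (ρ : ℝ) ^ 2 * (A (k n) : ℝ) * (4 * ((2 : ℝ) ^ n) ^ 2) := this
            _ = 4 * C * ((ρ : ℝ) ^ 2 * ((2 : ℝ) ^ n) ^ 2) * (A (k n) : ℝ) := by ring
        have s2 : D ^ 2 * (A (k (n + 1)) : ℝ) ≤ 256 * C * (M : ℝ) ^ 2 * (A (k n) : ℝ) := by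
          calc D ^ 2 * (A (k (n + 1)) : ℝ) ≤ 4 * C * ((ρ : ℝ) ^ 2 * ((2 : ℝ) ^ n) ^ 2) * (A (k n) : ℝ) := s1
            _ ≤ 4 * C * (64 * (M : ℝ) ^ 2) * (A (k n) : ℝ) := by
                have : 0 ≤ 4 * C := by positivity
                exact mul_le_mul_of_nonneg_right (mul_le_mul_of_nonneg_left hρsq this) hAn0
            _ = 256 * C * (M : ℝ) ^ 2 * (A (k n) : ℝ) := by ring
        -- multiply by `2^{nd}·2^d` and use `256·2^d·C·M² ≤ D²`
        have s3 : D ^ 2 * ((A (k (n + 1)) : ℝ) * (2 : ℝ) ^ ((n + 1) * d)) ≤ D ^ 2 * (M : ℝ) ^ d := by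
          calc D ^ 2 * ((A (k (n + 1)) : ℝ) * (2 : ℝ) ^ ((n + 1) * d))
              = (D ^ 2 * (A (k (n + 1)) : ℝ)) * ((2 : ℝ) ^ d * (2 : ℝ) ^ (n * d)) := by rw [e2]; ring
            _ ≤ (256 * C * (M : ℝ) ^ 2 * (A (k n) : ℝ)) * ((2 : ℝ) ^ d * (2 : ℝ) ^ (n * d)) :=
                mul_le_mul_of_nonneg_right s2 (by positivity)
            _ = (256 * (2 : ℝ) ^ d * C * (M : ℝ) ^ 2) * ((A (k n) : ℝ) * (2 : ℝ) ^ (n * d)) := by ring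
            _ ≤ D ^ 2 * (M : ℝ) ^ d := mul_le_mul hD2 hAn (by positivity) (by positivity)
        exact le_of_mul_le_mul_left s3 (by positivity)
      rw [le_div_iff₀ (by positivity)]
      exact key
  -- termination at the first power of two above `M`
  set nstar : ℕ := Nat.log 2 M + 1 with hnstar
  have hlt : M < 2 ^ nstar := Nat.lt_pow_succ_log_self (by norm_num) M
  have hle : 2 ^ nstar ≤ 2 * M := by
    have : 2 ^ Nat.log 2 M ≤ M := Nat.pow_log_le_self 2 (by omega)
    rw [hnstar, pow_succ]; omega
  have hfin := claim nstar hle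
  have hsmall : (M : ℝ) ^ d / (2 : ℝ) ^ (nstar * d) < 1 := by
    rw [div_lt_one (by positivity), pow_mul]
    have hltR : (M : ℝ) < (2 : ℝ) ^ nstar := by exact_mod_cast hlt
    exact pow_lt_pow_left₀ hltR hM0.le (by omega)
  have hzero : A (k nstar) = 0 := by
    have : (A (k nstar) : ℝ) < 1 := lt_of_le_of_lt hfin hsmall
    exact_mod_cast Nat.lt_one_iff.mp (by exact_mod_cast this)
  have := hmono (k nstar) D (hkD nstar)
  omega


end Summit.QuantumFields.YangMills.Theorems.Prop7FlatLevelIteration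

end
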